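import Summits.AtomisticToContinuum.FouriersLaw.Theorems.EmbeddedDrudeMourreAbelThermodynamicLimitFixedTimeOffsetMatchingSeveredLimit
import Summits.AtomisticToContinuum.FouriersLaw.Theorems.EmbeddedDrudeMourreAbelThermodynamicLimitFixedTimeOffsetMatchingProductForm
import Literature.MathematicalPhysics.KineticTheory.InfiniteChainGibbsUniqueness
import Literature.MathematicalPhysics.KineticTheory.InfiniteChainTightRegular
import Literature.Analysis.FunctionSpaces.TorusLipschitzFourierH1
import Literature.Analysis.FunctionSpaces.WeakCompactnessL1Proofs

/-!
# Leaf (B₀) `stub_fixedTimeOffsetMatching` of S4, glue part 3: (STATIC half) → (DYNAMIC half) → (B₀)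
(crux `EmbeddedDrudeMourre.AbelThermodynamicLimit`, item stmt-AtomisticToContinuum-12596, line
`loomis-compact-horizon-witness`; `--supports` file proving the registered reduction stub
`stub_fixedTimeOffsetMatchingOfLeaves`; closes nothing)

The registered leaf (B₀) (`⟨j_{c_N}(0) j_{c_N+x}(t)⟩_{N,T} → ∫ j_0 (j_x ∘ φ_t) dμT` for a regular witness `(μT, D)`)
follows, sorry-free and VERBATIM, from its two registered halves: `stub_centralWindowEnsembleEquivalence` (STATIC: the
laws of the centred embedding `ι_N z`, `z ∼ gibbsMeasure N T`, converge setwise on window events to the shift-invariant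
DLR state `μT`) and `stub_centralWindowDynamicalMatching` (DYNAMIC: at fixed `t` the current `j_x` of the embedded
open-chain path and of the severed flow of the centred box `{-R,…,R}`, from the same Gibbs configuration, differ by
more than `ε` with probability `≤ ε` under `gibbsMeasure N T ⊗ W`, for `R ≥ R₀` and all `N ≥ 2R + 4`).
Scheme (five `ε/5`'s): (1) product form of the pair correlation (part 2); (2) truncation at level `M` on the open
chain, `N`-uniformly (`N`-uniform fourth moments `pinnedChain_contactCurrentFourthMoment` + stationarity; §1);
(3) open chain → severed box flow (dynamic half, part 1 §3); (4) `gibbsMeasure N T → μT` on the bounded window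
observable `h_M(j_0) h_M(j_x ∘ T^{Λ_R}_t)` (static half + layer cake, part 1 §2; it is a window function by the
locality of the severed flow, part 2 §3); (5) severed → `D.flow` under `μT` (part 1 §4); (6) truncation under `μT`
(`L⁴(μT)` currents, invariance). The DLR-uniqueness and Green–Kubo clauses of (B₀) are carried, not used.

All statements proved; `[folklore]`. No definitions.
-/

noncomputable section

namespace Summit.AtomisticToContinuum.FouriersLaw.Theorems.AbelThermodynamicLimit.LoomisCompactHorizonWitness

open MeasureTheory ProbabilityTheory Set Filter Topology Function
open scoped NNReal ENNReal
open Literature.MathematicalPhysics.KineticTheory Literature.MathematicalPhysics.KineticTheory.HeatConduction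
open Literature.Probability.Process OscillatorChain
open Literature.Analysis.FunctionSpaces (abs_max_neg_min_le abs_clamp_le_abs abs_clamp_sub_clamp_le)
open Summit.AtomisticToContinuum.FouriersLaw.Theorems.NonBallistic
open Summit.AtomisticToContinuum.FouriersLaw.Theorems.SubdiffusiveBondHeat
open Summit.AtomisticToContinuum.FouriersLaw.Theorems.LightConeBondHeat (pinnedChain_abs_bondCurrent_le_exp
  quarter_inv_temp_admissible)

/-! ### §1 Truncation of the open-chain pair correlation, uniformly in `N` -/

section Truncation

variable {ω₂ lam β γ : ℝ} (hω : 0 < ω₂) (hl : 0 < lam) (hβ : 0 < β) (hγ : 0 < γ) {N : ℕ} (hN : 0 < N)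
  {T : ℝ} (hT : 0 < T)

include hω hl hβ hγ hN hT in
/-- **Truncation of the open-chain pair correlation at level `M`**, uniformly in `N`: with the `N`-uniform fourth
moment bound `C₄` of the bond currents under `μ_{N,T}` (and stationarity of the path at time `t`),
`|∫ j_c j_k(Φ_t) d(μ⊗W) − ∫ h_M(j_c) h_M(j_k(Φ_t)) d(μ⊗W)| ≤ (1 + 2C₄)/M`. [folklore] -/
theorem pinnedChain_abs_pairCorr_sub_clamp_le (c k : Fin N) (t : ℝ) {C₄ : ℝ}
    (hC₄ : ∀ i : Fin N, Integrable (fun x => (pinnedChain ω₂ lam β γ).bondCurrent N i x ^ 4)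
        ((pinnedChain ω₂ lam β γ).gibbsMeasure N T) ∧
      ∫ x, (pinnedChain ω₂ lam β γ).bondCurrent N i x ^ 4 ∂((pinnedChain ω₂ lam β γ).gibbsMeasure N T) ≤ C₄)
    (hint : Integrable (fun q : PhaseSpace N × WienerPair => (pinnedChain ω₂ lam β γ).bondCurrent N c q.1 *
        (pinnedChain ω₂ lam β γ).bondCurrent N k ((pinnedChain ω₂ lam β γ).solMap N T T t q.1 (pairPath q.2)))
      (((pinnedChain ω₂ lam β γ).gibbsMeasure N T).prod wienerPair))
    {M : ℝ} (hM : 0 < M) :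
    |(∫ q, (pinnedChain ω₂ lam β γ).bondCurrent N c q.1 *
          (pinnedChain ω₂ lam β γ).bondCurrent N k ((pinnedChain ω₂ lam β γ).solMap N T T t q.1 (pairPath q.2))
        ∂(((pinnedChain ω₂ lam β γ).gibbsMeasure N T).prod wienerPair)) -
      ∫ q, max (-M) (min M ((pinnedChain ω₂ lam β γ).bondCurrent N c q.1)) *
          max (-M) (min M ((pinnedChain ω₂ lam β γ).bondCurrent N k
            ((pinnedChain ω₂ lam β γ).solMap N T T t q.1 (pairPath q.2))))
        ∂(((pinnedChain ω₂ lam β γ).gibbsMeasure N T).prod wienerPair)| ≤ (1 + 2 * C₄) / M := by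
  set P := pinnedChain ω₂ lam β γ with hP
  set μ := P.gibbsMeasure N T with hμ
  haveI : IsProbabilityMeasure μ := pinnedChain_isProbabilityMeasure_gibbsMeasure hω hl.le hβ.le γ N hT
  have hΦm := pinnedChain_measurable_solMap_pairPath hω hl.le hβ.le hγ.le N T T t
  have hjcm : Measurable (P.bondCurrent N c) := (pinnedChain_continuous_bondCurrent ω₂ lam β γ N c).measurable
  have hjkm : Measurable (P.bondCurrent N k) := (pinnedChain_continuous_bondCurrent ω₂ lam β γ N k).measurable
  have ha4 : Integrable (fun q : PhaseSpace N × WienerPair => P.bondCurrent N c q.1 ^ 4) (μ.prod wienerPair) :=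
    (hC₄ c).1.comp_fst wienerPair
  have hb4 : Integrable (fun q : PhaseSpace N × WienerPair =>
      P.bondCurrent N k (P.solMap N T T t q.1 (pairPath q.2)) ^ 4) (μ.prod wienerPair) :=
    pinnedChain_integrable_comp_solMap_prod hω hl hβ hγ hN hT t (g := fun y => P.bondCurrent N k y ^ 4) (hC₄ k).1
  have key := abs_integral_mul_sub_integral_clamp_le (μ.prod wienerPair) (a := fun q => P.bondCurrent N c q.1)
    (b := fun q => P.bondCurrent N k (P.solMap N T T t q.1 (pairPath q.2))) (hjcm.comp measurable_fst)
    (hjkm.comp hΦm) hint ha4 hb4 hM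
  have e1 : ∫ q : PhaseSpace N × WienerPair, P.bondCurrent N c q.1 ^ 4 ∂(μ.prod wienerPair) =
      ∫ x, P.bondCurrent N c x ^ 4 ∂μ := by
    have h := integral_fun_fst (μ := μ) (ν := wienerPair) (fun x => P.bondCurrent N c x ^ 4)
    rw [h, probReal_univ, one_smul]
  have e2 : ∫ q : PhaseSpace N × WienerPair, P.bondCurrent N k (P.solMap N T T t q.1 (pairPath q.2)) ^ 4
      ∂(μ.prod wienerPair) = ∫ x, P.bondCurrent N k x ^ 4 ∂μ :=
    pinnedChain_integral_comp_solMap_prod hω hl hβ hγ hN hT t (g := fun y => P.bondCurrent N k y ^ 4)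
      (hC₄ k).1.aestronglyMeasurable
  rw [e1, e2] at key
  refine key.trans (div_le_div_of_nonneg_right ?_ hM.le)
  linarith [(hC₄ c).2, (hC₄ k).2]

end Truncation


/-- Chaining five `ε/5`-estimates. [folklore] -/
theorem abs_sub_lt_of_five {a₀ a₁ a₂ a₃ a₄ a₅ ε : ℝ} (h₁ : |a₀ - a₁| ≤ ε / 5) (h₂ : |a₁ - a₂| ≤ ε / 5)
    (h₃ : |a₂ - a₃| < ε / 5) (h₄ : |a₃ - a₄| < ε / 5) (h₅ : |a₄ - a₅| ≤ ε / 5) : |a₀ - a₅| < ε := by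
  have t1 := abs_sub_le a₀ a₁ a₅
  have t2 := abs_sub_le a₁ a₂ a₅
  have t3 := abs_sub_le a₂ a₃ a₅
  have t4 := abs_sub_le a₃ a₄ a₅
  linarith

/-! ### §2 The assembly: (STAT) → (DYN) → (B₀) -/

section Assembly

/-- **Registered reduction stub `stub_fixedTimeOffsetMatchingOfLeaves` — leaf (B₀) from its two registered halves
(at the given parameters and witness).** The static half
(`stub_centralWindowEnsembleEquivalence`: setwise convergence of the central-window laws of the free-boundary Gibbs
measures to the shift-invariant DLR state) and the dynamic half (`stub_centralWindowDynamicalMatching`: the open chain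
and the severed Hamiltonian flow of the centred box agree in probability at fixed time, uniformly in `N`) imply the
per-offset fixed-time two-dynamics matching VERBATIM: truncate both pair correlations at level `M` (`N`-uniform fourth
moments of the bond currents under `μ_{N,T}`, stationarity of the path; `L⁴(μT)` moments of `j_x`, invariance of
`μT`), pass from the open chain to the severed box flow (DYN), from `μ_{N,T}` to `μT` on the bounded window observable
(STAT + layer cake), and from the severed flow to `D.flow` (Buttà–Marchioro limit, dominated convergence). [folklore] -/
theorem stub_fixedTimeOffsetMatchingOfLeaves :
    ∀ ω₂ lam β γ : ℝ, 0 < ω₂ → 0 < lam → 0 < β → 0 < γ → ∀ T : ℝ, 0 < T →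
      ∀ (μT : MeasureTheory.Measure Literature.MathematicalPhysics.KineticTheory.HeatConduction.ChainConfig)
        (D : Literature.MathematicalPhysics.KineticTheory.HeatConduction.InfiniteChainDynamics
          (Literature.MathematicalPhysics.KineticTheory.HeatConduction.pinnedChain ω₂ lam β γ)),
        (Literature.MathematicalPhysics.KineticTheory.HeatConduction.pinnedChain ω₂ lam β γ).IsChainGibbsMeasure T μT →
        (Literature.MathematicalPhysics.KineticTheory.HeatConduction.pinnedChain ω₂ lam β γ).HasSuperstabilityEstimate μT →
        D.carrier ⊆ (Literature.MathematicalPhysics.KineticTheory.HeatConduction.pinnedChain ω₂ lam β γ).bmGood →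
        D.PreservesMeasure μT →
        (∀ t : ℝ, D.HasAbsConvergentCorrelation μT t) →
        (∀ ι : (N : ℕ) → Literature.MathematicalPhysics.KineticTheory.HeatConduction.PhaseSpace N →
            Literature.MathematicalPhysics.KineticTheory.HeatConduction.ChainConfig,
          (∀ (N : ℕ) (z : Literature.MathematicalPhysics.KineticTheory.HeatConduction.PhaseSpace N) (i : ℤ),
            ι N z i = if h : 0 ≤ i + ((N - 1) / 2 : ℕ) ∧ i + ((N - 1) / 2 : ℕ) < N then
              (z.1 ⟨(i + ((N - 1) / 2 : ℕ)).toNat, by omega⟩, z.2 ⟨(i + ((N - 1) / 2 : ℕ)).toNat, by omega⟩)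
              else (0, 0)) →
          ∀ (a : ℤ) (n : ℕ) (A : Set Literature.MathematicalPhysics.KineticTheory.HeatConduction.ChainConfig),
            MeasurableSet A →
            DependsOn (A.indicator (1 : Literature.MathematicalPhysics.KineticTheory.HeatConduction.ChainConfig → ENNReal))
              (↑(Finset.Icc a (a + n)) : Set ℤ) →
            Filter.Tendsto (fun N : ℕ =>
                ((Literature.MathematicalPhysics.KineticTheory.HeatConduction.pinnedChain ω₂ lam β γ).gibbsMeasure N T).real
                  ((ι N) ⁻¹' A)) Filter.atTop (nhds (μT.real A))) →
        (∀ (hB1 : (Literature.MathematicalPhysics.KineticTheory.HeatConduction.pinnedChain ω₂ lam β γ).CondB1)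
            (ι : (N : ℕ) → Literature.MathematicalPhysics.KineticTheory.HeatConduction.PhaseSpace N →
              Literature.MathematicalPhysics.KineticTheory.HeatConduction.ChainConfig),
          (∀ (N : ℕ) (z : Literature.MathematicalPhysics.KineticTheory.HeatConduction.PhaseSpace N) (i : ℤ),
            ι N z i = if h : 0 ≤ i + ((N - 1) / 2 : ℕ) ∧ i + ((N - 1) / 2 : ℕ) < N then
              (z.1 ⟨(i + ((N - 1) / 2 : ℕ)).toNat, by omega⟩, z.2 ⟨(i + ((N - 1) / 2 : ℕ)).toNat, by omega⟩)
              else (0, 0)) →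
          ∀ (t : ℝ), 0 ≤ t → ∀ (x : ℤ) (ε : ℝ), 0 < ε → ∃ R₀ : ℕ, ∀ R : ℕ, R₀ ≤ R → ∀ N : ℕ, 2 * R + 4 ≤ N →
            (((Literature.MathematicalPhysics.KineticTheory.HeatConduction.pinnedChain ω₂ lam β γ).gibbsMeasure N T).prod
                Literature.Probability.Process.wienerPair)
              {q : Literature.MathematicalPhysics.KineticTheory.HeatConduction.PhaseSpace N ×
                  Literature.Probability.Process.WienerPair |
                ε < |(Literature.MathematicalPhysics.KineticTheory.HeatConduction.pinnedChain ω₂ lam β γ).bondCurrentZ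
                      (ι N ((Literature.MathematicalPhysics.KineticTheory.HeatConduction.pinnedChain ω₂ lam β γ).solMap
                        N T T t q.1 (Literature.Probability.Process.pairPath q.2))) x -
                    (Literature.MathematicalPhysics.KineticTheory.HeatConduction.pinnedChain ω₂ lam β γ).bondCurrentZ
                      (Literature.MathematicalPhysics.KineticTheory.HeatConduction.OscillatorChain.severedFlow hB1
                        (Finset.Icc (-(R : ℤ)) R) t (ι N q.1)) x|} ≤ ENNReal.ofReal ε) →
        ∀ (x : ℤ) (t : ℝ), 0 < t →
          Filter.Tendsto (fun N : ℕ =>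
              if hN : 2 * x.natAbs + 2 ≤ N then
                ∫ z, (Literature.MathematicalPhysics.KineticTheory.HeatConduction.pinnedChain
                        ω₂ lam β γ).bondCurrent N ⟨(N - 1) / 2, by omega⟩ z *
                  (∫ y, (Literature.MathematicalPhysics.KineticTheory.HeatConduction.pinnedChain
                        ω₂ lam β γ).bondCurrent N ⟨((((N - 1) / 2 : ℕ) : ℤ) + x).toNat, by omega⟩ y
                    ∂((Literature.MathematicalPhysics.KineticTheory.HeatConduction.pinnedChain
                        ω₂ lam β γ).transitionKernel N T T t.toNNReal z))
                  ∂((Literature.MathematicalPhysics.KineticTheory.HeatConduction.pinnedChain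
                        ω₂ lam β γ).gibbsMeasure N T)
              else 0)
            Filter.atTop
            (nhds (∫ σ, (Literature.MathematicalPhysics.KineticTheory.HeatConduction.pinnedChain
                      ω₂ lam β γ).bondCurrentZ σ 0 *
              (Literature.MathematicalPhysics.KineticTheory.HeatConduction.pinnedChain
                      ω₂ lam β γ).bondCurrentZ (D.flow t σ) x ∂μT)) := by
  intro ω₂ lam β γ hω hl hβ hγ T hT μT D hG hss hcar hPres hAC hSTAT hDYN x t ht

  haveI hμT : IsProbabilityMeasure μT := hG.isProbabilityMeasure
  have hB1 : (pinnedChain ω₂ lam β γ).CondB1 := condB1_pinnedChain hω.le hl.le hβ.le γ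
  have hU2 : ContDiff ℝ 2 (pinnedChain ω₂ lam β γ).U := (pinnedChain_isEvenPolyOfDegree_U β γ hω.le hl).contDiff_two
  have hV2 : ContDiff ℝ 2 (pinnedChain ω₂ lam β γ).V := (pinnedChain_isEvenPolyOfDegree_V ω₂ lam γ hβ).contDiff_two
  -- the centred embedding
  set ι : (N : ℕ) → PhaseSpace N → ChainConfig := fun N z i =>
    if h : 0 ≤ i + ((N - 1) / 2 : ℕ) ∧ i + ((N - 1) / 2 : ℕ) < N then
      (z.1 ⟨(i + ((N - 1) / 2 : ℕ)).toNat, by omega⟩, z.2 ⟨(i + ((N - 1) / 2 : ℕ)).toNat, by omega⟩)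
    else (0, 0) with hιdef
  have hι : ∀ (N : ℕ) (z : PhaseSpace N) (i : ℤ), ι N z i =
      if h : 0 ≤ i + ((N - 1) / 2 : ℕ) ∧ i + ((N - 1) / 2 : ℕ) < N then
        (z.1 ⟨(i + ((N - 1) / 2 : ℕ)).toNat, by omega⟩, z.2 ⟨(i + ((N - 1) / 2 : ℕ)).toNat, by omega⟩)
      else (0, 0) := fun N z i => rfl
  have hιm : ∀ N, Measurable (ι N) := measurable_centredEmbedding ι hι
  haveI hμN : ∀ N : ℕ, IsProbabilityMeasure ((pinnedChain ω₂ lam β γ).gibbsMeasure N T) := fun N =>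
    pinnedChain_isProbabilityMeasure_gibbsMeasure hω hl.le hβ.le γ N hT
  -- `N`-uniform fourth moments of the bond currents under `μ_{N,T}`
  obtain ⟨C₄, hC₄0, hC₄⟩ := pinnedChain_contactCurrentFourthMoment ω₂ lam β γ hω hl.le hβ.le T hT
  -- fourth moments under `μT`
  have hj4 : ∀ y : ℤ, Integrable (fun σ => (pinnedChain ω₂ lam β γ).bondCurrentZ σ y ^ 4) μT := by
    intro y
    have h := (memLp_bondCurrentZ_pinnedChain γ hω.le hl.le hβ hss y (p := ((4 : ℕ) : ℝ≥0∞)) (by simp)).integrable_norm_pow'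
    refine h.congr (Eventually.of_forall fun σ => ?_)
    simp only [Real.norm_eq_abs, pow_abs]
    exact abs_of_nonneg (by positivity)
  set CT : ℝ := (∫ σ, (pinnedChain ω₂ lam β γ).bondCurrentZ σ 0 ^ 4 ∂μT) +
    ∫ σ, (pinnedChain ω₂ lam β γ).bondCurrentZ σ x ^ 4 ∂μT with hCT
  have hCT0 : 0 ≤ CT := add_nonneg (integral_nonneg fun σ => by positivity) (integral_nonneg fun σ => by positivity)
  -- the clamp
  have hcm : ∀ M : ℝ, Measurable fun r : ℝ => max (-M) (min M r) := fun M => (continuous_clamp M).measurable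
  rw [Metric.tendsto_atTop]
  intro ε hε
  -- the truncation level `M`
  obtain ⟨M, hM0, hM1, hM2⟩ : ∃ M : ℝ, 0 < M ∧ (1 + 2 * C₄) / M ≤ ε / 5 ∧ (1 + CT) / M ≤ ε / 5 := by
    refine ⟨(1 + 2 * C₄ + CT) * (5 / ε) + 1, by positivity, ?_, ?_⟩
    · rw [div_le_iff₀ (by positivity)]
      have : (1 + 2 * C₄) ≤ ε / 5 * ((1 + 2 * C₄ + CT) * (5 / ε)) := by
        rw [show ε / 5 * ((1 + 2 * C₄ + CT) * (5 / ε)) = 1 + 2 * C₄ + CT by field_simp]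
        linarith
      nlinarith
    · rw [div_le_iff₀ (by positivity)]
      have : (1 + CT) ≤ ε / 5 * ((1 + 2 * C₄ + CT) * (5 / ε)) := by
        rw [show ε / 5 * ((1 + 2 * C₄ + CT) * (5 / ε)) = 1 + 2 * C₄ + CT by field_simp]
        linarith
      nlinarith
  -- the probability tolerance `δ` and the dynamic half
  set δ : ℝ := ε / 5 / (M * (1 + 2 * M)) with hδ
  have hδ0 : 0 < δ := by positivity
  have hMδ : M * (1 + 2 * M) * δ = ε / 5 := by
    rw [hδ]; field_simp
  obtain ⟨R₀, hR₀⟩ := hDYN hB1 ι hι t ht.le x δ hδ0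
  -- the severed limit
  have hsev := tendsto_integral_clamp_bondCurrentZ_severedFlow hω hl hβ hB1 (μT := μT) D hcar hPres t x hM0.le
  obtain ⟨R₁, hR₁⟩ := Metric.tendsto_atTop.1 hsev (ε / 5) (by positivity)
  -- fix the box radius
  set R : ℕ := max (max R₀ R₁) (x.natAbs + 1) with hR
  have hR₀R : R₀ ≤ R := le_trans (le_max_left _ _) (le_max_left _ _)
  have hR₁R : R₁ ≤ R := le_trans (le_max_right _ _) (le_max_left _ _)
  have hxR : x.natAbs + 1 ≤ R := le_max_right _ _
  -- the window observable `G` and the static half (layer cake on the pushed-forward measures)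
  set G : ChainConfig → ℝ := fun σ => max (-M) (min M ((pinnedChain ω₂ lam β γ).bondCurrentZ σ 0)) *
    max (-M) (min M ((pinnedChain ω₂ lam β γ).bondCurrentZ
      (severedFlow hB1 (Finset.Icc (-(R : ℤ)) R) t σ) x)) with hGdef
  have hGm : Measurable G := ((hcm M).comp (measurable_bondCurrentZ _ 0)).mul
    ((hcm M).comp ((measurable_bondCurrentZ _ x).comp (measurable_severedFlow hB1 _ hU2 hV2 t)))
  have hGbd : ∀ σ, |G σ| ≤ M * M := fun σ => by
    rw [hGdef]; dsimp only; rw [abs_mul]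
    exact mul_le_mul (abs_max_neg_min_le hM0.le _) (abs_max_neg_min_le hM0.le _) (abs_nonneg _) hM0.le
  have hGdep : ∀ σ σ' : ChainConfig, (∀ j : ℤ, -((R : ℤ) + 1) ≤ j → j ≤ (R : ℤ) + 1 → σ j = σ' j) → G σ = G σ' := by
    intro σ σ' hσσ'
    have h0 : σ 0 = σ' 0 := hσσ' 0 (by omega) (by omega)
    have h1 : σ 1 = σ' 1 := hσσ' 1 (by omega) (by omega)
    have hx0 := severedFlow_Icc_apply_eq_of_forall_eq hB1 hU2 hV2 R hσσ' t (i := x)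
      (by simp only [Finset.mem_Icc]; omega)
    have hx1 := severedFlow_Icc_apply_eq_of_forall_eq hB1 hU2 hV2 R hσσ' t (i := x + 1)
      (by simp only [Finset.mem_Icc]; omega)
    simp only [hGdef, OscillatorChain.bondCurrentZ, zero_add, h0, h1, hx0, hx1]
  have hGconv : Tendsto (fun N : ℕ => ∫ z, G (ι N z) ∂((pinnedChain ω₂ lam β γ).gibbsMeasure N T)) atTop
      (𝓝 (∫ σ, G σ ∂μT)) := by
    -- the pushed-forward measures and the shifted non-negative observable `f = G + M²`
    set ν : ℕ → Measure ChainConfig := fun N => ((pinnedChain ω₂ lam β γ).gibbsMeasure N T).map (ι N) with hν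
    haveI : ∀ N, IsProbabilityMeasure (ν N) := fun N => Measure.isProbabilityMeasure_map (hιm N).aemeasurable
    set f : ChainConfig → ℝ := fun σ => G σ + M * M with hf
    have hfm : Measurable f := hGm.add_const _
    have hf0 : ∀ σ, 0 ≤ f σ := fun σ => by have := hGbd σ; rw [abs_le] at this; simp only [hf]; linarith
    have hfC : ∀ σ, f σ ≤ 2 * (M * M) := fun σ => by have := hGbd σ; rw [abs_le] at this; simp only [hf]; linarith
    have hlevel : ∀ s : ℝ, 0 < s → Tendsto (fun N => (ν N).real {σ | s < f σ}) atTop (𝓝 (μT.real {σ | s < f σ})) := by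
      intro s hs
      have hA : MeasurableSet {σ | s < f σ} := measurableSet_lt measurable_const hfm
      have hAd : DependsOn ({σ | s < f σ}.indicator (1 : ChainConfig → ℝ≥0∞))
          (↑(Finset.Icc (-((R : ℤ) + 1)) (-((R : ℤ) + 1) + ↑(2 * R + 2))) : Set ℤ) := by
        intro σ σ' hσσ'
        have hGG : G σ = G σ' := hGdep σ σ' fun j hj1 hj2 => hσσ' j (by
          simp only [Finset.coe_Icc, Set.mem_Icc]; push_cast; omega)
        have : (σ ∈ {σ | s < f σ}) ↔ (σ' ∈ {σ | s < f σ}) := by simp only [Set.mem_setOf_eq, hf, hGG]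
        by_cases h : σ ∈ {σ | s < f σ}
        · rw [Set.indicator_of_mem h, Set.indicator_of_mem (this.1 h)]; rfl
        · rw [Set.indicator_of_notMem h, Set.indicator_of_notMem (fun h' => h (this.2 h'))]
      have h := hSTAT ι hι (-((R : ℤ) + 1)) (2 * R + 2) _ hA hAd
      refine h.congr fun N => ?_
      rw [hν]; dsimp only
      rw [map_measureReal_apply (hιm N) hA]
    have hconv := tendsto_integral_of_tendsto_measureReal_superlevel ν μT hfm hf0 hfC hlevel
    have e1 : ∀ N, ∫ σ, f σ ∂(ν N) = (∫ z, G (ι N z) ∂((pinnedChain ω₂ lam β γ).gibbsMeasure N T)) + M * M := by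
      intro N
      rw [hν]; dsimp only
      rw [integral_map (hιm N).aemeasurable hfm.aestronglyMeasurable]
      simp only [hf]
      rw [integral_add _ (integrable_const _), integral_const, smul_eq_mul, probReal_univ, one_mul]
      exact (integrable_const (M * M)).mono' (hGm.comp (hιm N)).aestronglyMeasurable
        (Eventually.of_forall fun z => by rw [Real.norm_eq_abs]; exact hGbd _)
    have e2 : ∫ σ, f σ ∂μT = (∫ σ, G σ ∂μT) + M * M := by
      simp only [hf]
      rw [integral_add _ (integrable_const _), integral_const, smul_eq_mul, probReal_univ, one_mul]
      exact (integrable_const (M * M)).mono' hGm.aestronglyMeasurable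
        (Eventually.of_forall fun z => by rw [Real.norm_eq_abs]; exact hGbd _)
    simp_rw [e1, e2] at hconv
    have := hconv.sub_const (M * M)
    simpa only [add_sub_cancel_right] using this
  obtain ⟨N₁, hN₁⟩ := Metric.tendsto_atTop.1 hGconv (ε / 5) (by positivity)
  -- the threshold
  refine ⟨max N₁ (2 * R + 4 + 2 * x.natAbs), fun N hN => ?_⟩
  have hN₁N : N₁ ≤ N := le_trans (le_max_left _ _) hN
  have hNR : 2 * R + 4 ≤ N := by have := le_trans (le_max_right _ _) hN; omega
  have hNx : 2 * x.natAbs + 2 ≤ N := by have := le_trans (le_max_right _ _) hN; omega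
  have hN0 : 0 < N := by omega
  rw [dif_pos hNx, Real.dist_eq]
  -- the two bonds
  set c : Fin N := ⟨(N - 1) / 2, by omega⟩ with hc
  set k : Fin N := ⟨((((N - 1) / 2 : ℕ) : ℤ) + x).toNat, by omega⟩ with hk
  have hc1 : c.val + 1 < N := by simp only [hc]; omega
  have hk1 : k.val + 1 < N := by simp only [hk]; omega
  have hcz : (c : ℤ) = 0 + ((N - 1) / 2 : ℕ) := by simp [hc]
  have hkz : (k : ℤ) = x + ((N - 1) / 2 : ℕ) := by simp only [hk]; omega
  have hida : ∀ z : PhaseSpace N, (pinnedChain ω₂ lam β γ).bondCurrent N c z = (pinnedChain ω₂ lam β γ).bondCurrentZ (ι N z) 0 :=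
    fun z => bondCurrent_eq_bondCurrentZ_centredEmbedding _ ι hι z 0 c hc1 hcz
  have hidb : ∀ y : PhaseSpace N, (pinnedChain ω₂ lam β γ).bondCurrent N k y = (pinnedChain ω₂ lam β γ).bondCurrentZ (ι N y) x :=
    fun y => bondCurrent_eq_bondCurrentZ_centredEmbedding _ ι hι y x k hk1 hkz
  -- Step 1: product form; Step 2: truncation on the open chain
  obtain ⟨hint, hprod⟩ := pinnedChain_pairCorr_eq_integral_prod hω hl hβ hγ hN0 hT c k ht.le
  have h2 := pinnedChain_abs_pairCorr_sub_clamp_le hω hl hβ hγ hN0 hT c k t (C₄ := C₄) (fun i => hC₄ N i) hint hM0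
  rw [hprod]
  simp only [hida, hidb] at h2 ⊢
  -- Step 3: the dynamic half at `(R, N)`
  have hΦm := pinnedChain_measurable_solMap_pairPath hω hl.le hβ.le hγ.le N T T t
  have hbad := hR₀ R hR₀R N hNR
  have h3 := abs_integral_clamp_mul_clamp_sub_le_of_measure_lt
    (((pinnedChain ω₂ lam β γ).gibbsMeasure N T).prod wienerPair)
    (a := fun q : PhaseSpace N × WienerPair => (pinnedChain ω₂ lam β γ).bondCurrentZ (ι N q.1) 0)
    (b := fun q : PhaseSpace N × WienerPair => (pinnedChain ω₂ lam β γ).bondCurrentZ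
      (ι N ((pinnedChain ω₂ lam β γ).solMap N T T t q.1 (pairPath q.2))) x)
    (b' := fun q : PhaseSpace N × WienerPair => (pinnedChain ω₂ lam β γ).bondCurrentZ
      (severedFlow hB1 (Finset.Icc (-(R : ℤ)) R) t (ι N q.1)) x)
    ((measurable_bondCurrentZ _ 0).comp ((hιm N).comp measurable_fst))
    ((measurable_bondCurrentZ _ x).comp ((hιm N).comp hΦm))
    ((measurable_bondCurrentZ _ x).comp ((measurable_severedFlow hB1 _ hU2 hV2 t).comp ((hιm N).comp measurable_fst)))
    hM0 hδ0 hbad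
  rw [hMδ] at h3
  -- Step 4: the severed integrand only depends on `z`: it is `∫ G ∘ ι_N dμ_N`
  have h4 : ∫ q : PhaseSpace N × WienerPair, max (-M) (min M ((pinnedChain ω₂ lam β γ).bondCurrentZ (ι N q.1) 0)) *
      max (-M) (min M ((pinnedChain ω₂ lam β γ).bondCurrentZ (severedFlow hB1 (Finset.Icc (-(R : ℤ)) R) t (ι N q.1)) x))
      ∂(((pinnedChain ω₂ lam β γ).gibbsMeasure N T).prod wienerPair) =
      ∫ z, G (ι N z) ∂((pinnedChain ω₂ lam β γ).gibbsMeasure N T) := by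
    have h := integral_fun_fst (μ := (pinnedChain ω₂ lam β γ).gibbsMeasure N T) (ν := wienerPair) (fun z => G (ι N z))
    rw [probReal_univ, one_smul] at h
    exact h
  rw [h4] at h3
  have h4' := hN₁ N hN₁N
  rw [Real.dist_eq] at h4'
  -- Step 5: the severed limit at `R`
  have h5 := hR₁ R hR₁R
  rw [Real.dist_eq] at h5
  -- Step 6: truncation under `μT`
  have hab : Integrable (fun σ => (pinnedChain ω₂ lam β γ).bondCurrentZ σ 0 *
      (pinnedChain ω₂ lam β γ).bondCurrentZ (D.flow t σ) x) μT := (hAC t).1 x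
  have hb4T : Integrable (fun σ => (pinnedChain ω₂ lam β γ).bondCurrentZ (D.flow t σ) x ^ 4) μT :=
    ((hPres.2 t).integrable_comp (hj4 x).aestronglyMeasurable).2 (hj4 x)
  have h6 := abs_integral_mul_sub_integral_clamp_le μT (a := fun σ => (pinnedChain ω₂ lam β γ).bondCurrentZ σ 0)
    (b := fun σ => (pinnedChain ω₂ lam β γ).bondCurrentZ (D.flow t σ) x) (measurable_bondCurrentZ _ 0)
    ((measurable_bondCurrentZ _ x).comp (hPres.2 t).measurable) hab (hj4 0) hb4T hM0
  have e6 : ∫ σ, (pinnedChain ω₂ lam β γ).bondCurrentZ (D.flow t σ) x ^ 4 ∂μT =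
      ∫ σ, (pinnedChain ω₂ lam β γ).bondCurrentZ σ x ^ 4 ∂μT := by
    have hg' : AEStronglyMeasurable (fun σ => (pinnedChain ω₂ lam β γ).bondCurrentZ σ x ^ 4) (μT.map (D.flow t)) := by
      rw [(hPres.2 t).map_eq]; exact (hj4 x).aestronglyMeasurable
    have h := integral_map (hPres.2 t).measurable.aemeasurable hg'
    rw [(hPres.2 t).map_eq] at h
    exact h.symm
  rw [e6] at h6
  have h6' : |(∫ σ, (pinnedChain ω₂ lam β γ).bondCurrentZ σ 0 * (pinnedChain ω₂ lam β γ).bondCurrentZ (D.flow t σ) x ∂μT) -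
      ∫ σ, max (-M) (min M ((pinnedChain ω₂ lam β γ).bondCurrentZ σ 0)) *
        max (-M) (min M ((pinnedChain ω₂ lam β γ).bondCurrentZ (D.flow t σ) x)) ∂μT| ≤ ε / 5 :=
    h6.trans (by rw [add_assoc, ← hCT]; exact hM2)
  have h2' := h2.trans hM1
  -- combine
  rw [abs_sub_comm] at h6'
  exact abs_sub_lt_of_five h2' h3 h4' h5 h6'

end Assembly
end Summit.AtomisticToContinuum.FouriersLaw.Theorems.AbelThermodynamicLimit.LoomisCompactHorizonWitness

end
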